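import Literature.AlgebraicGeometry.Resolution.FormalFibresRegularProofs
import Literature.AlgebraicGeometry.Resolution.AdicCompletionRegular
import Literature.AlgebraicGeometry.Resolution.DerivationCompletion
import Mathlib.RingTheory.AdicCompletion.Algebra
import Mathlib.RingTheory.AdicCompletion.LocalRing
import Mathlib.RingTheory.Ideal.Quotient.PowTransition
import Mathlib.Algebra.CharP.Algebra
import Mathlib.FieldTheory.Perfect
import HarnessLib

/-!
# Crux `Steer` (stmt-16345), r8 `stub_core4Iso`, piece I `isol_transfer` — seam Ic (completion plumbing), part 1:
# extending a ring hom to the adic completion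

OURS (campaign `res-hironaka`, rung L, slot W4.1, chain W4.1; replaces the role of no printed item; NOT a
statement of the manuscript under review). The universal property of the adic completion for maps INTO an
adically complete ring: a ring hom `φ : R → S` with `φ(I) ⊆ J`, `S` `J`-adically complete, extends to
`φ̂ : R̂_I → S` with `φ̂ ∘ of = φ` (Mathlib has the dual `AdicCompletion.liftRingHom` — maps INTO a
completion — and `AdicCompletion.ofAlgEquiv` for complete `S`; we compose them). Used to extend a formal
chart `φ : R → κ⟦X⟧` of a regular local `R` to `R̂ ≅ k'⟦Y⟧` (DICT-SIGS `isol_transfer`, seam Ic).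
No `Theses.*` / `Cruxes.*` import. [folklore]
-/

-- layout-mandated namespace `Summit.<Summit>.<Problem>.…` with Summit = Problem (single-conjunct summit)
set_option linter.dupNamespace false

namespace Summit.ResolutionOfSingularities.ResolutionOfSingularities.Theorems.SwitchingDichotomy.Isol

open AdicCompletion

/-- The level-`n` maps `R̂_I → S ⧸ J ^ n` induced by `φ : R → S` with `φ(I) ⊆ J`:
`x ↦ φ(x mod I ^ n) mod J ^ n`. (Auxiliary; inlined as a term in the statements below.) [folklore] -/
theorem pow_le_comap_pow {R S : Type*} [CommRing R] [CommRing S] (I : Ideal R) (J : Ideal S)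
    (φ : R →+* S) (hφ : I.map φ ≤ J) (n : ℕ) : I ^ n ≤ (J ^ n).comap φ := by
  rw [← Ideal.map_le_iff_le_comap, Ideal.map_pow]
  exact Ideal.pow_right_mono hφ n

/-- **Extension of a ring hom to the adic completion.** Let `φ : R → S` be a ring hom with
`φ(I) ⊆ J` and `S` `J`-adically complete. Then there is a ring hom `φ̂ : AdicCompletion I R → S` with
`φ̂ (of x) = φ x` for all `x ∈ R`. [folklore] -/
theorem exists_ringHom_adicCompletion_extend {R S : Type*} [CommRing R] [CommRing S] (I : Ideal R)
    (J : Ideal S) [IsAdicComplete J S] (φ : R →+* S) (hφ : I.map φ ≤ J) :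
    ∃ ψ : AdicCompletion I R →+* S, ∀ x : R, ψ (AdicCompletion.of I R x) = φ x := by
  -- the compatible family of level maps
  let f : (n : ℕ) → AdicCompletion I R →+* S ⧸ J ^ n := fun n =>
    (Ideal.quotientMap (J ^ n) φ (pow_le_comap_pow I J φ hφ n)).comp (evalₐ I n).toRingHom
  have hf : ∀ {m n : ℕ} (hle : m ≤ n), (Ideal.Quotient.factorPow J hle).comp (f n) = f m := by
    intro m n hle
    ext x
    induction x using AdicCompletion.induction_on with
    | h seq =>
      simp only [f, RingHom.coe_comp, Function.comp_apply, AlgHom.toRingHom_eq_coe,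
        RingHom.coe_coe, evalₐ_mk, Ideal.quotientMap_mk, Ideal.Quotient.factorPow,
        Ideal.Quotient.factor_mk]
      have h := congrArg (Ideal.quotientMap (J ^ m) φ (pow_le_comap_pow I J φ hφ m))
        (AdicCompletion.Ideal.mk_eq_mk I hle seq)
      rw [Ideal.quotientMap_mk, Ideal.quotientMap_mk] at h
      rw [h]
  refine ⟨((ofAlgEquiv J (S := S)).symm : AdicCompletion J S →+* S).comp (liftRingHom J f hf),
    fun x => ?_⟩
  have hlift : liftRingHom J f hf (AdicCompletion.of I R x) = AdicCompletion.of J S (φ x) := by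
    refine ext_evalₐ fun n => ?_
    rw [evalₐ_liftRingHom, evalₐ_of]
    simp only [f, RingHom.coe_comp, Function.comp_apply, AlgHom.toRingHom_eq_coe, RingHom.coe_coe,
      evalₐ_of, Ideal.quotientMap_mk]
  rw [RingHom.coe_comp, Function.comp_apply, hlift]
  exact ofAlgEquiv_symm_of J (φ x)

/-! ### Transport of `ℤ`-derivations along a ring isomorphism, and to the completion -/

/-- **Conjugating a `ℤ`-derivation by a ring isomorphism**: for `e : A ≃+* B` and `δ ∈ Der_ℤ(A, A)`
there is `δ' ∈ Der_ℤ(B, B)` with `δ' (e a) = e (δ a)`. [folklore] -/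
theorem exists_derivation_ringEquiv_conj {A B : Type*} [CommRing A] [CommRing B] (e : A ≃+* B)
    (δ : Derivation ℤ A A) : ∃ δ' : Derivation ℤ B B, ∀ a : A, δ' (e a) = e (δ a) := by
  let L : B →+ B := (e : A →+* B).toAddMonoidHom.comp (δ.toLinearMap.toAddMonoidHom.comp
    (e.symm : B →+* A).toAddMonoidHom)
  have hL : ∀ b, L b = e (δ (e.symm b)) := fun b => rfl
  refine ⟨Derivation.mk' L.toIntLinearMap fun x y => ?_, fun a => ?_⟩
  · change L (x * y) = x • L y + y • L x
    simp only [hL, map_mul, Derivation.leibniz, smul_eq_mul, map_add, RingEquiv.apply_symm_apply]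
  · change L (e a) = e (δ a)
    rw [hL, e.symm_apply_apply]

/-- **Derivations extend to the adic completion** (the tree's `derivationAdicCompletion`, Stacks 07PE, read
for `N = A`): for `δ ∈ Der_ℤ(A, A)` there is `δ̂ ∈ Der_ℤ(Â, Â)` with `δ̂ (of a) = of (δ a)`. [folklore] -/
theorem exists_derivation_adicCompletion {A : Type*} [CommRing A] (I : Ideal A) (δ : Derivation ℤ A A) :
    ∃ δ' : Derivation ℤ (AdicCompletion I A) (AdicCompletion I A),
      ∀ a : A, δ' (AdicCompletion.of I A a) = AdicCompletion.of I A (δ a) :=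
  ⟨Literature.AlgebraicGeometry.Resolution.derivationAdicCompletion I δ,
    Literature.AlgebraicGeometry.Resolution.derivationAdicCompletion_of I δ⟩

/-! ### Cohen coordinates on the completion of a regular local ring of characteristic `p` -/

/-- The image of the prime field `ℤ/p` in a ring of characteristic `p` (`p` prime) is a FIELD (as a
subring). [folklore] -/
theorem isField_range_zmod_castHom (p : ℕ) [Fact p.Prime] {A : Type*} [CommRing A] [Nontrivial A]
    [CharP A p] : IsField ((ZMod.castHom (dvd_refl p) A).range) := by
  let ι : ZMod p →+* A := ZMod.castHom (dvd_refl p) A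
  have hι : Function.Injective ι := ι.injective
  let e : ZMod p ≃+* ι.range := RingEquiv.ofBijective ι.rangeRestrict
    ⟨fun x y h => hι (congrArg Subtype.val h), RingHom.rangeRestrict_surjective ι⟩
  exact MulEquiv.isField (Field.toIsField (ZMod p)) e.symm.toMulEquiv

open IsLocalRing in
/-- **Cohen coordinates on `R̂`.** For a regular local ring `R` of characteristic `p` with embedding dimension
`d`, the `𝔪`-adic completion `R̂` is isomorphic to `k'⟦Y₁, …, Y_d⟧` with `k'` the residue field of `R̂`
(tree: `exists_ringEquiv_mvPowerSeries_residueField`, Cohen's structure theorem with the prime field as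
coefficient subfield; `emb dim R̂ = emb dim R`). [cite: Matsumura1987, Thm. 29.7] -/
theorem exists_ringEquiv_adicCompletion_mvPowerSeries (p : ℕ) [Fact p.Prime] {R : Type}
    [CommRing R] [IsRegularLocalRing R] [CharP R p] (d : ℕ) (hd : (maximalIdeal R).spanFinrank = d) :
    Nonempty (AdicCompletion (maximalIdeal R) R ≃+*
      MvPowerSeries (Fin d) (ResidueField (AdicCompletion (maximalIdeal R) R))) := by
  haveI : IsRegularLocalRing (AdicCompletion (maximalIdeal R) R) :=
    Literature.AlgebraicGeometry.Resolution.isRegularLocalRing_adicCompletion R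
  haveI : CharP (AdicCompletion (maximalIdeal R) R) p :=
    charP_of_injective_algebraMap (AdicCompletion.of_injective (maximalIdeal R) R) p
  obtain ⟨e⟩ := Literature.AlgebraicGeometry.Resolution.exists_ringEquiv_mvPowerSeries_residueField
    (AdicCompletion (maximalIdeal R) R)
    (ZMod.castHom (dvd_refl p) (AdicCompletion (maximalIdeal R) R)).range (isField_range_zmod_castHom p)
  have hdA : (maximalIdeal (AdicCompletion (maximalIdeal R) R)).spanFinrank = d := by
    rw [AdicCompletion.spanFinrank_maximalIdeal_eq, hd]
  exact ⟨e.trans (MvPowerSeries.renameEquiv _ (finCongr hdA)).toRingEquiv⟩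

end Summit.ResolutionOfSingularities.ResolutionOfSingularities.Theorems.SwitchingDichotomy.Isol
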